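import Literature.Computability.Cryptography.QuantumTuringMachinePositioned
import HarnessLib

/-!
# When the tree's acceptance probability is Bernstein–Vazirani's: head-oblivious superpositions

Sibling file of `QuantumTuringMachinePositioned.lean` (Bernstein–Vazirani's positioned model
`QTM.PCfg = M.Cfg × ℤ`, `QTM.pevolve`, `QTM.pstateAt`, `QTM.pacceptProbAt`, and the projection
`QTM.mapDomain_fst_pstateAt : fst_* (M.pstateAt x t) = M.stateAt x t`). The tree's model
identifies translates, so in general `QTM.acceptProbAt ≠ QTM.pacceptProbAt` (the `RotationWalk`
example of `QuantumComplexity/QuantumTuringProofs.lean`). This file isolates the hypothesis under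
which the two acceptance functionals AGREE, in the form needed by simulation constructions
(`BQP ⊆ BQPQTM`, Nishimura–Ozawa 2002, Lemma 5.1; Bernstein–Vazirani 1997, Thm. 8.3): all
positioned configurations in the superposition at the observation time have the SAME head
position — a *head-oblivious* superposition, as for Bernstein–Vazirani's synchronous
constructions in which the head trajectory does not depend on the computation path (BV 1997,
App. B, Def. B.5: "a deterministic TM is oblivious if its running time and the position of its
tape head at each time step depend only on the length of its input"; all quantum data of a
circuit simulation lives on the tape).

* `QTM.mapDomain_place_mapDomain_fst` — a superposition all of whose configurations sit at head
  position `ξ` is its projection placed at `ξ`; hence (`QTM.sum_mapDomain_fst_of_forall_snd_eq`)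
  every observation functional of the control state / head-relative configuration takes the same
  value on it and on its projection;
* `QTM.acceptProbAt_eq_pacceptProbAt` — if `M.pstateAt x t` is head-oblivious then
  `M.acceptProbAt x t = M.pacceptProbAt x t`;
* `QTM.exists_of_mem_support_pevolveWith` — support tracing for one positioned step (every
  configuration in the support of `U ψ` is reached from one in the support of `ψ` by a
  transition of non-zero amplitude, the position moving by `∓1`), and the two one-directional
  consequences `QTM.forall_snd_eq_pevolveWith_of_left/right` (if from the configurations present
  the kernel only moves left, resp. right, a head-oblivious superposition stays head-oblivious),
  the induction step provers use to establish the hypothesis.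

Nothing here is specific to well-formed machines. No named fact is introduced.

## References

* E. Bernstein, U. Vazirani, *Quantum complexity theory*, SIAM J. Comput. 26 (1997) 1411–1473
  [BernsteinVaziraniSICOMP1997]: Def. 3.2 (configurations with head position, time evolution),
  Def. 3.4 (observation), App. B Def. B.5 (oblivious machines), Thm. 4.3 / B.8–B.9
  (synchronous reversible simulation), Thm. 8.3.
* H. Nishimura, M. Ozawa, *Computational complexity of uniform quantum circuit families and
  quantum Turing machines*, Theoret. Comput. Sci. 276 (2002) 147–181 [NishimuraOzawa2002],
  Lemma 5.1 (QTMs carry out uniform circuit families).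
-/

noncomputable section

namespace Literature.Computability.Cryptography

namespace QTM

open Turing Finsupp
open scoped BigOperators

variable (M : QTM)

/-! ### Head-oblivious superpositions project faithfully -/

/-- A positioned superposition all of whose configurations have head position `ξ` is its
projection to head-relative configurations, placed back at `ξ`. [folklore] -/
theorem mapDomain_place_mapDomain_fst (φ : M.PCfg →₀ ℂ) (ξ : ℤ)
    (hξ : ∀ c ∈ φ.support, c.2 = ξ) :
    Finsupp.mapDomain (M.place ξ) (Finsupp.mapDomain Prod.fst φ) = φ := by
  rw [← Finsupp.mapDomain_comp]
  conv_rhs => rw [← Finsupp.mapDomain_id (v := φ)]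
  refine Finsupp.mapDomain_congr fun c hc => ?_
  obtain ⟨c₁, k⟩ := c
  have hk : k = ξ := hξ _ hc
  subst hk
  rfl

/-- On a head-oblivious positioned superposition, every observation functional that only reads
the head-relative configuration has the same value as on the projected superposition
(Bernstein–Vazirani 1997, Def. 3.4: observing a part of the configuration). [cite: BernsteinVaziraniSICOMP1997, Def. 3.4] -/
theorem sum_mapDomain_fst_of_forall_snd_eq (φ : M.PCfg →₀ ℂ) (ξ : ℤ)
    (hξ : ∀ c ∈ φ.support, c.2 = ξ) (g : M.Cfg → ℂ → ℝ) :
    ((Finsupp.mapDomain Prod.fst φ).sum g) = φ.sum fun c a => g c.1 a := by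
  conv_rhs => rw [← M.mapDomain_place_mapDomain_fst φ ξ hξ]
  rw [Finsupp.sum_mapDomain_index_inj (M.place_injective ξ)]
  rfl

/-- **The tree's acceptance probability is Bernstein–Vazirani's for head-oblivious runs.** If at
the observation time `t` all positioned configurations of `M` on input `x` with non-zero
amplitude have the same head position, then `M.acceptProbAt x t = M.pacceptProbAt x t`: no two
translates are superposed, so the identification of translates in the tree's model
(`QTM.mapDomain_fst_pstateAt`) adds nothing. This is the situation of Bernstein–Vazirani's
synchronous, oblivious constructions (App. B, Def. B.5; Thm. 8.3) and of Nishimura–Ozawa's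
simulation of circuit families (Lemma 5.1), where the head trajectory is independent of the
computation path. [cite: BernsteinVaziraniSICOMP1997, Def. 3.4 and App. B Def. B.5] -/
theorem acceptProbAt_eq_pacceptProbAt (x : List Bool) (t : ℕ) (ξ : ℤ)
    (hξ : ∀ c ∈ (M.pstateAt x t).support, c.2 = ξ) :
    M.acceptProbAt x t = M.pacceptProbAt x t := by
  unfold acceptProbAt pacceptProbAt
  rw [← M.mapDomain_fst_pstateAt x t]
  exact M.sum_mapDomain_fst_of_forall_snd_eq _ ξ hξ fun c a => if c.q = M.accept then ‖a‖ ^ 2 else 0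

/-- Likewise for the squared length: a head-oblivious positioned superposition and its
projection have the same `ℓ²` norm. [folklore] -/
theorem normSq_mapDomain_fst_of_forall_snd_eq (φ : M.PCfg →₀ ℂ) (ξ : ℤ)
    (hξ : ∀ c ∈ φ.support, c.2 = ξ) :
    M.normSq (Finsupp.mapDomain Prod.fst φ) = sqNorm φ := by
  unfold normSq
  rw [M.sum_mapDomain_fst_of_forall_snd_eq φ ξ hξ fun _ a => ‖a‖ ^ 2]
  rfl

/-! ### Support tracing for one positioned step -/

/-- The support of the one-configuration contribution `pstep`: every positioned configuration
with non-zero amplitude in it is reached by a transition of non-zero amplitude, the head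
position moving by `-1` (left) or `+1` (right) (Bernstein–Vazirani 1997, Def. 3.2). [cite: BernsteinVaziraniSICOMP1997, Def. 3.2] -/
theorem exists_of_mem_support_pstep (δ' : M.Kernel) (c : M.PCfg) (a : ℂ) (c' : M.PCfg)
    (h : c' ∈ (M.pstep δ' c a).support) :
    ∃ (q : M.Λ) (b : M.Γ),
      (δ' c.1.q c.1.tape.head q b Dir.left ≠ 0 ∧
          c' = ((⟨q, (c.1.tape.write b).move Dir.left⟩ : M.Cfg), c.2 - 1)) ∨
        (δ' c.1.q c.1.tape.head q b Dir.right ≠ 0 ∧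
          c' = ((⟨q, (c.1.tape.write b).move Dir.right⟩ : M.Cfg), c.2 + 1)) := by
  classical
  unfold pstep at h
  obtain ⟨q, -, hq⟩ := Finset.mem_biUnion.1 (Finsupp.support_finsetSum h)
  obtain ⟨b, -, hb⟩ := Finset.mem_biUnion.1 (Finsupp.support_finsetSum hq)
  refine ⟨q, b, ?_⟩
  rcases Finset.mem_union.1 (Finsupp.support_add hb) with hL | hR
  · left
    have hne : a * δ' c.1.q c.1.tape.head q b Dir.left ≠ 0 := by
      intro h0
      rw [h0, zero_smul] at hL
      simp at hL
    refine ⟨right_ne_zero_of_mul hne, ?_⟩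
    have := Finsupp.support_smul hL
    simpa using Finsupp.support_single_subset this
  · right
    have hne : a * δ' c.1.q c.1.tape.head q b Dir.right ≠ 0 := by
      intro h0
      rw [h0, zero_smul] at hR
      simp at hR
    refine ⟨right_ne_zero_of_mul hne, ?_⟩
    have := Finsupp.support_smul hR
    simpa using Finsupp.support_single_subset this

/-- **Support tracing.** Every positioned configuration in the support of `U ψ` is reached from
one in the support of `ψ` by a transition of non-zero amplitude, the head position moving by
`∓1` (Bernstein–Vazirani 1997, Def. 3.2). [cite: BernsteinVaziraniSICOMP1997, Def. 3.2] -/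
theorem exists_of_mem_support_pevolveWith (δ' : M.Kernel) (ψ : M.PCfg →₀ ℂ) (c' : M.PCfg)
    (h : c' ∈ (M.pevolveWith δ' ψ).support) :
    ∃ c ∈ ψ.support, ∃ (q : M.Λ) (b : M.Γ),
      (δ' c.1.q c.1.tape.head q b Dir.left ≠ 0 ∧
          c' = ((⟨q, (c.1.tape.write b).move Dir.left⟩ : M.Cfg), c.2 - 1)) ∨
        (δ' c.1.q c.1.tape.head q b Dir.right ≠ 0 ∧
          c' = ((⟨q, (c.1.tape.write b).move Dir.right⟩ : M.Cfg), c.2 + 1)) := by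
  classical
  unfold pevolveWith at h
  obtain ⟨c, hc, hc'⟩ := Finset.mem_biUnion.1 (Finsupp.support_sum h)
  exact ⟨c, hc, M.exists_of_mem_support_pstep δ' c (ψ c) c' hc'⟩

/-- **Oblivious step, moving left.** If all configurations of `ψ` have head position `ξ` and,
from the (state, scanned symbol) pairs present in `ψ`, the kernel has no right-moving
transition, then all configurations of `U ψ` have head position `ξ - 1`. [folklore] -/
theorem forall_snd_eq_pevolveWith_of_left (δ' : M.Kernel) (ψ : M.PCfg →₀ ℂ) (ξ : ℤ)
    (hξ : ∀ c ∈ ψ.support, c.2 = ξ)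
    (hdir : ∀ c ∈ ψ.support, ∀ q b, δ' c.1.q c.1.tape.head q b Dir.right = 0) :
    ∀ c' ∈ (M.pevolveWith δ' ψ).support, c'.2 = ξ - 1 := by
  intro c' hc'
  obtain ⟨c, hc, q, b, h⟩ := M.exists_of_mem_support_pevolveWith δ' ψ c' hc'
  rcases h with ⟨-, rfl⟩ | ⟨hne, -⟩
  · simp [hξ c hc]
  · exact absurd (hdir c hc q b) hne

/-- **Oblivious step, moving right.** If all configurations of `ψ` have head position `ξ` and,
from the (state, scanned symbol) pairs present in `ψ`, the kernel has no left-moving transition,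
then all configurations of `U ψ` have head position `ξ + 1`. [folklore] -/
theorem forall_snd_eq_pevolveWith_of_right (δ' : M.Kernel) (ψ : M.PCfg →₀ ℂ) (ξ : ℤ)
    (hξ : ∀ c ∈ ψ.support, c.2 = ξ)
    (hdir : ∀ c ∈ ψ.support, ∀ q b, δ' c.1.q c.1.tape.head q b Dir.left = 0) :
    ∀ c' ∈ (M.pevolveWith δ' ψ).support, c'.2 = ξ + 1 := by
  intro c' hc'
  obtain ⟨c, hc, q, b, h⟩ := M.exists_of_mem_support_pevolveWith δ' ψ c' hc'
  rcases h with ⟨hne, -⟩ | ⟨-, rfl⟩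
  · exact absurd (hdir c hc q b) hne
  · simp [hξ c hc]

/-- The initial positioned superposition is head-oblivious (position `0`). [folklore] -/
theorem forall_snd_eq_pstateAt_zero (x : List Bool) :
    ∀ c ∈ (M.pstateAt x 0).support, c.2 = 0 := by
  intro c hc
  have h := Finsupp.support_single_subset hc
  rw [Finset.mem_singleton] at h
  subst h
  rfl

/-- One step of `pstateAt`. [folklore] -/
theorem pstateAt_succ (x : List Bool) (t : ℕ) :
    M.pstateAt x (t + 1) = M.pevolve (M.pstateAt x t) :=
  Function.iterate_succ_apply' _ _ _

end QTM

end Literature.Computability.Cryptography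

end
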